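import Summits.ResolutionOfSingularities.ResolutionOfSingularities.Theorems.LassoCutModel
import HarnessLib

/-!
# LassoCutClasses — the pieces and EXACT cuts of the node «LassoCut» (§2) and the finite-field bridge (§3)
(decomp-res node N57, lens-5 g13 sha256 a9bc663c66df87f5; CRITIC-LEDGER row 78 CLEARED; file 2 of 4, namespace
`…Theorems.LassoCut` continued from `Theorems.LassoCutModel`, whose module docstring is the node's card.)

§2: `NoLassos` (Σ₁ half), `NoAperiodicWalks` (Π half, the located residual), `NoDefectLassosDeep` /
`NoAperiodicDefectWalksDeep` (the same cut of `DefectWalksTerminateDeep` = MaxContactCut 31770), `NoSatLassos`; kernels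
`not_walksTerminate_of_lasso` (CERTIFICATE), `walksTerminate_iff_lasso`, `defectDeep_iff_lasso` (EXACT, logic + pumping).
§3: over FINITE `K` bounded complexity boxes are finite (`finite_box`), so bounded divergence is periodic
(`exists_repeat_of_bounded`) and aperiodic divergence escapes (`unbounded_of_aperiodic`):
`FinWalksTerminate ⟺ NoFinLassos ∧ NoEscapingWalks`, `NoFinLassos ⟺ NoBoxTowers`.  The MaxContactCut-side edges
(`halves_of_noForcedTowers`, `defectWalksDeep_iff_lasso`) are in `Theorems.MaxContactCutLassoCut`.
(Sources: Hauser2010 §§F–G; HauserPerlega2019 §1; Moh1987; CossartPiltant2019 p. 4.)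
-/

open MvPolynomial
open Literature.AlgebraicGeometry.Resolution
open Literature.AlgebraicGeometry.Resolution.Hauser2010
open Literature.AlgebraicGeometry.Resolution.PointBlowup
open Summit.ResolutionOfSingularities.ResolutionOfSingularities.Theorems.TightDefectClasses
open Summit.ResolutionOfSingularities.ResolutionOfSingularities.Theorems.WeakOrderReduction
open Summit.ResolutionOfSingularities.ResolutionOfSingularities.Theorems.ForcedTowerClasses

namespace Summit.ResolutionOfSingularities.ResolutionOfSingularities.Theorems.LassoCut

/-! ## §2 The pieces (|σ| = 3, all perfect `K` of characteristic `p`) and the EXACT cuts -/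

section Pieces

/-- **`NoLassos`** — the Σ₁ HALF of the crux: no root state admits a lasso.  [WEAKER by letter (`noLassos_of_walks`,
pumping) · Σ₁: a failure is a FINITE forced run, a kernel-checkable certificate (`not_walksTerminate_of_lasso`) ·
INSTRUMENTABLE-WITH-CERTIFICATE (recipe replay / relabelled-cycle searches of the census) · decided cell
`no_cornerMonoChart_lasso` · a proof in general: IDEA-NEEDED (rigidity of the cycle's functional equation)]
(Sources: HauserPerlega2019, §1; Hauser2010, §G.) -/
def NoLassos : Prop :=
  ∀ p : ℕ, p.Prime → ∀ e : ℕ, 1 ≤ e → ∀ (K : Type) [Field K] [CharP K p] [PerfectField K] [DecidableEq K]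
    (s₀ : State (Fin 3) K), IsRoot (p ^ e) s₀ → Lasso (p ^ e) s₀ → False

/-- **`NoAperiodicWalks`** — the Π HALF (the located residual): no root state admits an infinite forced walk that
never revisits a state.  [WEAKER by letter (`noAperiodic_of_walks`) · instrument-dark: no finite computation refutes it ·
over finite fields = ESCAPING towers (`unbounded_of_aperiodic`) · IDEA-NEEDED] (Sources: Hauser2010, §G; Moh1987, p.1.) -/
def NoAperiodicWalks : Prop :=
  ∀ p : ℕ, p.Prime → ∀ e : ℕ, 1 ≤ e → ∀ (K : Type) [Field K] [CharP K p] [PerfectField K] [DecidableEq K]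
    (s₀ : State (Fin 3) K), IsRoot (p ^ e) s₀ → ∀ W : ForcedWalk (p ^ e) s₀, Aperiodic W → False

/-- **`NoDefectLassosDeep`** — the Σ₁ half of item 31770 (`e ≥ 2`, positive tight defect along the run).
[WEAKER by letter (`noDefectLassosDeep_of_defectDeep`) · certificate channel `not_defectDeep_of_lasso` ·
INSTRUMENTABLE-WITH-CERTIFICATE at `q = p²`] (Sources: CossartPiltant2019, p.4; Hauser2010, §G.) -/
def NoDefectLassosDeep : Prop :=
  ∀ p : ℕ, p.Prime → ∀ e : ℕ, 2 ≤ e → ∀ (K : Type) [Field K] [CharP K p] [PerfectField K] [DecidableEq K]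
    (s₀ : State (Fin 3) K), IsRoot (p ^ e) s₀ → ∀ L : Lasso (p ^ e) s₀, L.PosDefect → False

/-- **`NoAperiodicDefectWalksDeep`** — the Π half of item 31770: no aperiodic infinite forced walk with positive tight
defect throughout at `e ≥ 2`.  [WEAKER by letter · the located residual of 31770 under this cut · IDEA-NEEDED]
(Sources: CossartPiltant2019, p.4; Moh1987, p.1.) -/
def NoAperiodicDefectWalksDeep : Prop :=
  ∀ p : ℕ, p.Prime → ∀ e : ℕ, 2 ≤ e → ∀ (K : Type) [Field K] [CharP K p] [PerfectField K] [DecidableEq K]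
    (s₀ : State (Fin 3) K), IsRoot (p ^ e) s₀ → ∀ W : ForcedWalk (p ^ e) s₀, (∀ i, 1 ≤ (W.st i).shade) →
    Aperiodic W → False

/-- **`NoSatLassos`** — the Σ₁ shadow of the SATELLITE COLUMN: no positive-defect lasso with a satellite point inside its
cycle.  [WEAKER by letter than `SatDefectWalksTerminate` (`noSatLassos_of_satDefect`) · certificate channel
`not_satDefect_of_lasso` · exactly what the census's «S₃-relabelled recipe replay» tests] (Sources: Hauser2010, §G.) -/
def NoSatLassos : Prop :=
  ∀ p : ℕ, p.Prime → ∀ e : ℕ, 1 ≤ e → ∀ (K : Type) [Field K] [CharP K p] [PerfectField K] [DecidableEq K]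
    (s₀ : State (Fin 3) K), IsRoot (p ^ e) s₀ → ∀ L : Lasso (p ^ e) s₀, L.PosDefect → L.SatCycle → False

/-! ### Kernels: necessity (pumping), sufficiency (dichotomy), exactness -/

/-- **CERTIFICATE**: one lasso from a root refutes the model crux. [PROVED, pumping] [folklore] -/
theorem not_walksTerminate_of_lasso {p e : ℕ} (hp : p.Prime) (he : 1 ≤ e) {K : Type} [Field K] [CharP K p]
    [PerfectField K] [DecidableEq K] {s₀ : State (Fin 3) K} (hs : IsRoot (p ^ e) s₀) (L : Lasso (p ^ e) s₀) :
    ¬ WalksTerminate :=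
  fun h => h p hp e he K s₀ hs L.pump

/-- **CERTIFICATE (31770)**: one positive-defect lasso at `e ≥ 2` refutes `DefectWalksTerminateDeep`. [PROVED] [folklore] -/
theorem not_defectDeep_of_lasso {p e : ℕ} (hp : p.Prime) (he : 2 ≤ e) {K : Type} [Field K] [CharP K p]
    [PerfectField K] [DecidableEq K] {s₀ : State (Fin 3) K} (hs : IsRoot (p ^ e) s₀) (L : Lasso (p ^ e) s₀)
    (hL : L.PosDefect) : ¬ DefectWalksTerminateDeep :=
  fun h => h p hp e he K s₀ hs L.pump (L.pump_shade hL)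

/-- **CERTIFICATE (satellite column)**: one positive-defect lasso with a satellite in its cycle refutes
`SatDefectWalksTerminate`. [PROVED] [folklore] -/
theorem not_satDefect_of_lasso {p e : ℕ} (hp : p.Prime) (he : 1 ≤ e) {K : Type} [Field K] [CharP K p]
    [PerfectField K] [DecidableEq K] {s₀ : State (Fin 3) K} (hs : IsRoot (p ^ e) s₀) (L : Lasso (p ^ e) s₀)
    (hL : L.PosDefect) (hS : L.SatCycle) : ¬ SatDefectWalksTerminate :=
  fun h => h p hp e he K s₀ hs L.pump (L.pump_shade hL) (L.pump_satellite_io hS)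

/-- `WalksTerminate ⟹ NoLassos`. [PROVED, pumping] [folklore] -/
theorem noLassos_of_walks (h : WalksTerminate) : NoLassos :=
  fun p hp e he K _ _ _ _ s₀ hs L => h p hp e he K s₀ hs L.pump

/-- `WalksTerminate ⟹ NoAperiodicWalks`. [PROVED, instantiation] [folklore] -/
theorem noAperiodic_of_walks (h : WalksTerminate) : NoAperiodicWalks :=
  fun p hp e he K _ _ _ _ s₀ hs W _ => h p hp e he K s₀ hs W

/-- **Sufficiency**: the two halves give the crux back (dichotomy periodic / aperiodic). [PROVED] [folklore] -/
theorem walks_of_halves (hL : NoLassos) (hA : NoAperiodicWalks) : WalksTerminate := by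
  intro p hp e he K _ _ _ _ s₀ hs W
  rcases aperiodic_or_repeat W with hW | ⟨t₀, t₁, hlt, heq⟩
  · exact hA p hp e he K s₀ hs W hW
  · exact hL p hp e he K s₀ hs (lassoOf W hlt heq)

/-- **THE CUT (EXACT)**: `WalksTerminate ⟺ NoLassos ∧ NoAperiodicWalks`. [PROVED] [folklore] -/
theorem walksTerminate_iff_lasso : WalksTerminate ↔ NoLassos ∧ NoAperiodicWalks :=
  ⟨fun h => ⟨noLassos_of_walks h, noAperiodic_of_walks h⟩, fun h => walks_of_halves h.1 h.2⟩

/-- `DefectWalksTerminateDeep ⟹ NoDefectLassosDeep`. [PROVED, pumping] [folklore] -/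
theorem noDefectLassosDeep_of_defectDeep (h : DefectWalksTerminateDeep) : NoDefectLassosDeep :=
  fun p hp e he K _ _ _ _ s₀ hs L hL => h p hp e he K s₀ hs L.pump (L.pump_shade hL)

/-- `DefectWalksTerminateDeep ⟹ NoAperiodicDefectWalksDeep`. [PROVED] [folklore] -/
theorem noAperiodicDefectDeep_of_defectDeep (h : DefectWalksTerminateDeep) : NoAperiodicDefectWalksDeep :=
  fun p hp e he K _ _ _ _ s₀ hs W hW _ => h p hp e he K s₀ hs W hW

/-- **Sufficiency for 31770.** [PROVED] [folklore] -/
theorem defectDeep_of_halves (hL : NoDefectLassosDeep) (hA : NoAperiodicDefectWalksDeep) :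
    DefectWalksTerminateDeep := by
  intro p hp e he K _ _ _ _ s₀ hs W hW
  rcases aperiodic_or_repeat W with hA' | ⟨t₀, t₁, hlt, heq⟩
  · exact hA p hp e he K s₀ hs W hW hA'
  · exact hL p hp e he K s₀ hs (lassoOf W hlt heq) (fun i _ => hW i)

/-- **THE CUT OF 31770 (EXACT)**: `DefectWalksTerminateDeep ⟺ NoDefectLassosDeep ∧ NoAperiodicDefectWalksDeep`.
[PROVED] [folklore] -/
theorem defectDeep_iff_lasso : DefectWalksTerminateDeep ↔ NoDefectLassosDeep ∧ NoAperiodicDefectWalksDeep :=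
  ⟨fun h => ⟨noDefectLassosDeep_of_defectDeep h, noAperiodicDefectDeep_of_defectDeep h⟩,
    fun h => defectDeep_of_halves h.1 h.2⟩

/-- `SatDefectWalksTerminate ⟹ NoSatLassos` (necessity of the satellite-cycle piece). [PROVED, pumping] [folklore] -/
theorem noSatLassos_of_satDefect (h : SatDefectWalksTerminate) : NoSatLassos :=
  fun p hp e he K _ _ _ _ s₀ hs L hL hS => h p hp e he K s₀ hs L.pump (L.pump_shade hL) (L.pump_satellite_io hS)

/-- … and conversely the two halves give the slice `PolyPureTowersTerminate` modulo the dictionary port. [PROVED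
mod port] [folklore] -/
theorem polyPureTowersTerminate_of_halves (hD : TowerDictionary) (hL : NoLassos) (hA : NoAperiodicWalks) :
    PolyPureTowersTerminate :=
  polyPureTowersTerminate_of_model hD (walks_of_halves hL hA)

end Pieces

/-! ## §3 The bridge: FINITE FIELDS — bounded divergence is periodic, aperiodic divergence escapes (pigeonhole) -/

section FiniteFields

variable {K : Type} [Field K] [DecidableEq K]

/-- The COMPLEXITY of a state: total degree of the residual polynomial plus the boundary mass `|r|`.
DEFINITION (support). -/
noncomputable def cx (s : State (Fin 3) K) : ℕ := s.F.totalDegree + s.r.degree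

omit [DecidableEq K] in
/-- A coefficient outside the box vanishes. [folklore] -/
theorem coeff_eq_zero_of_cx_le {s : State (Fin 3) K} {D : ℕ} (h : cx s ≤ D) {d : Fin 3 →₀ ℕ} {i : Fin 3}
    (hi : D < d i) : coeff d s.F = 0 := by
  by_contra hne
  have hmem : d ∈ s.F.support := MvPolynomial.mem_support_iff.mpr hne
  have h1 : (d.sum fun _ n => n) ≤ s.F.totalDegree := MvPolynomial.le_totalDegree hmem
  have h2' : (d.sum fun _ n => n) = d.degree := rfl
  have h2 : d i ≤ d.degree := by
    rw [Finsupp.degree_eq_sum]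
    exact Finset.single_le_sum (fun k _ => Nat.zero_le (d k)) (Finset.mem_univ i)
  have h3 : s.F.totalDegree ≤ D := le_trans (Nat.le_add_right _ _) h
  omega

omit [DecidableEq K] in
/-- A boundary multiplicity inside the box. [folklore] -/
theorem r_le_of_cx_le {s : State (Fin 3) K} {D : ℕ} (h : cx s ≤ D) (i : Fin 3) : s.r i ≤ D := by
  have h1 : s.r i ≤ s.r.degree := by
    rw [Finsupp.degree_eq_sum]
    exact Finset.single_le_sum (fun k _ => Nat.zero_le (s.r k)) (Finset.mem_univ i)
  have h2 : s.r.degree ≤ D := le_trans (Nat.le_add_left _ _) h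
  omega

omit [DecidableEq K] in
/-- **Finite box**: over a FINITE field the states of complexity `≤ D` form a finite set. [folklore] -/
theorem finite_box [Fintype K] (D : ℕ) : {s : State (Fin 3) K | cx s ≤ D}.Finite := by
  classical
  let enc : State (Fin 3) K → ((Fin 3 → Fin (D + 1)) → K) × (Fin 3 → Fin (D + 1)) := fun s =>
    (fun d => coeff (Finsupp.equivFunOnFinite.symm fun i => ((d i : Fin (D + 1)) : ℕ)) s.F,
      fun i => ⟨min (s.r i) D, by omega⟩)
  refine Set.Finite.of_finite_image (Set.toFinite (enc '' _)) ?_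
  intro s hs s' hs' hss'
  have hF : s.F = s'.F := by
    ext d
    by_cases hd : ∀ i, d i ≤ D
    · have h1 := congrArg (fun φ => φ.1 (fun i => (⟨d i, by have := hd i; omega⟩ : Fin (D + 1)))) hss'
      have hdd : (Finsupp.equivFunOnFinite.symm fun i => ((⟨d i, by have := hd i; omega⟩ : Fin (D + 1)) : ℕ)) = d :=
        Finsupp.ext fun i => rfl
      simpa [enc, hdd] using h1
    · push Not at hd
      obtain ⟨i, hi⟩ := hd
      rw [coeff_eq_zero_of_cx_le hs hi, coeff_eq_zero_of_cx_le hs' hi]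
  have hr : s.r = s'.r := by
    ext i
    have h1 := congrArg (fun φ => ((φ.2 i : Fin (D + 1)) : ℕ)) hss'
    have h2 : min (s.r i) D = min (s'.r i) D := by simpa [enc] using h1
    have := r_le_of_cx_le hs i
    have := r_le_of_cx_le hs' i
    omega
  cases s
  cases s'
  simp only [State.mk.injEq]
  exact ⟨hF, hr⟩

/-- **Bounded divergence is periodic** (pigeonhole): over a finite field an infinite forced walk of bounded complexity
revisits a state. [folklore] -/
theorem exists_repeat_of_bounded [Fintype K] {q : ℕ} {s₀ : State (Fin 3) K} (W : ForcedWalk q s₀) {D : ℕ}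
    (hD : ∀ t, cx (W.st t) ≤ D) : ∃ t₀ t₁, t₀ < t₁ ∧ W.st t₁ = W.st t₀ := by
  obtain ⟨a, b, hab, h⟩ :=
    Set.Finite.exists_lt_map_eq_of_forall_mem (f := W.st) (fun t => (hD t : W.st t ∈ {s | cx s ≤ D})) (finite_box D)
  exact ⟨a, b, hab, h.symm⟩

/-- **Aperiodic divergence ESCAPES**: over a finite field an aperiodic infinite forced walk leaves every complexity box
(`deg F_t + |r_t|` is unbounded along it). [folklore] -/
theorem unbounded_of_aperiodic [Fintype K] {q : ℕ} {s₀ : State (Fin 3) K} (W : ForcedWalk q s₀) (hW : Aperiodic W)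
    (D : ℕ) : ∃ t, D < cx (W.st t) := by
  by_contra h
  push Not at h
  obtain ⟨t₀, t₁, hlt, heq⟩ := exists_repeat_of_bounded W h
  exact hW t₀ t₁ hlt heq

/-- **`FinWalksTerminate`** — the model crux over FINITE ground fields.  [WEAKER by letter (instantiation,
`finWalks_of_walks`) · ⟺ `WalksTerminate` at each degree modulo lens-5 g11's two classical ports (finite-field
criterion) · EXACT cut `finWalksTerminate_iff`] (Sources: Marker2002, Thm 2.1.4.) -/
def FinWalksTerminate : Prop :=
  ∀ p : ℕ, p.Prime → ∀ e : ℕ, 1 ≤ e → ∀ (K : Type) [Field K] [CharP K p] [PerfectField K] [DecidableEq K] [Fintype K]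
    (s₀ : State (Fin 3) K), IsRoot (p ^ e) s₀ → ForcedWalk (p ^ e) s₀ → False

/-- **`NoFinLassos`** — no lasso from a root over a finite field: per `(p, e, K, D, B)` a FINITE, DECIDABLE statement;
the base range of the lens.  [WEAKER by letter · Σ₁ · INSTRUMENTABLE-WITH-CERTIFICATE] (Sources:
HauserPerlega2019, §1.) -/
def NoFinLassos : Prop :=
  ∀ p : ℕ, p.Prime → ∀ e : ℕ, 1 ≤ e → ∀ (K : Type) [Field K] [CharP K p] [PerfectField K] [DecidableEq K] [Fintype K]
    (s₀ : State (Fin 3) K), IsRoot (p ^ e) s₀ → Lasso (p ^ e) s₀ → False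

/-- **`NoEscapingWalks`** — the ASYMPTOTIC REGIME, the located residual over finite fields: no infinite forced walk from
a root along which the complexity `deg F_t + |r_t|` is UNBOUNDED.  [WEAKER by letter (`noEscaping_of_finWalks`) · EXACT
complement of `NoFinLassos` (`finWalksTerminate_iff`) · instrument-dark · IDEA-NEEDED (a growth law for `deg F_t`
along equimultiple isolated walks)] (Sources: Hauser2010, §G; Moh1987, p.1.) -/
def NoEscapingWalks : Prop :=
  ∀ p : ℕ, p.Prime → ∀ e : ℕ, 1 ≤ e → ∀ (K : Type) [Field K] [CharP K p] [PerfectField K] [DecidableEq K] [Fintype K]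
    (s₀ : State (Fin 3) K), IsRoot (p ^ e) s₀ → ∀ W : ForcedWalk (p ^ e) s₀, (∀ D : ℕ, ∃ t, D < cx (W.st t)) → False

/-- **`NoBoxTowers`** — the FINITE RANGE: no infinite forced walk of BOUNDED complexity over a finite field.
[WEAKER · DECIDED MOD `NoFinLassos` (`noBoxTowers_of_noFinLassos`, pigeonhole): in every box the lasso piece is the
whole story] (Sources: Hauser2010, §G; Moh1987, p.1.) -/
def NoBoxTowers : Prop :=
  ∀ p : ℕ, p.Prime → ∀ e : ℕ, 1 ≤ e → ∀ (K : Type) [Field K] [CharP K p] [PerfectField K] [DecidableEq K] [Fintype K]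
    (s₀ : State (Fin 3) K), IsRoot (p ^ e) s₀ → ∀ W : ForcedWalk (p ^ e) s₀, (∃ D : ℕ, ∀ t, cx (W.st t) ≤ D) → False

/-- `WalksTerminate ⟹ FinWalksTerminate`. [PROVED, instantiation] [folklore] -/
theorem finWalks_of_walks (h : WalksTerminate) : FinWalksTerminate :=
  fun p hp e he K _ _ _ _ _ s₀ hs W => h p hp e he K s₀ hs W

/-- `FinWalksTerminate ⟹ NoFinLassos`. [PROVED, pumping] [folklore] -/
theorem noFinLassos_of_finWalks (h : FinWalksTerminate) : NoFinLassos :=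
  fun p hp e he K _ _ _ _ _ s₀ hs L => h p hp e he K s₀ hs L.pump

/-- `NoLassos ⟹ NoFinLassos`. [PROVED, instantiation] [folklore] -/
theorem noFinLassos_of_noLassos (h : NoLassos) : NoFinLassos :=
  fun p hp e he K _ _ _ _ _ s₀ hs L => h p hp e he K s₀ hs L

/-- `FinWalksTerminate ⟹ NoEscapingWalks`. [PROVED] [folklore] -/
theorem noEscaping_of_finWalks (h : FinWalksTerminate) : NoEscapingWalks :=
  fun p hp e he K _ _ _ _ _ s₀ hs W _ => h p hp e he K s₀ hs W

/-- **Bounded divergence is periodic**: `NoFinLassos ⟹ NoBoxTowers`. [PROVED, pigeonhole + restriction] [folklore] -/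
theorem noBoxTowers_of_noFinLassos (h : NoFinLassos) : NoBoxTowers := by
  intro p hp e he K _ _ _ _ _ s₀ hs W hW
  obtain ⟨D, hD⟩ := hW
  obtain ⟨t₀, t₁, hlt, heq⟩ := exists_repeat_of_bounded W hD
  exact h p hp e he K s₀ hs (lassoOf W hlt heq)

/-- **A lasso pumps to a BOUNDED tower** (its states are the finitely many states of the cycle), so over a finite field
`NoBoxTowers ⟹ NoFinLassos`: the Σ₁ piece IS the bounded-complexity regime. [folklore] -/
theorem noFinLassos_of_noBoxTowers (h : NoBoxTowers) : NoFinLassos := by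
  intro p hp e he K _ _ _ _ _ s₀ hs L
  refine h p hp e he K s₀ hs L.pump ⟨(Finset.range L.t₁).sup (fun i => cx (L.run.st i)), fun t => ?_⟩
  rw [L.pump_st]
  exact Finset.le_sup (f := fun i => cx (L.run.st i)) (Finset.mem_range.mpr (L.clock_lt t))

/-- **EXACT: over finite fields, no lassos ⟺ no bounded towers.** [folklore] -/
theorem noFinLassos_iff_noBoxTowers : NoFinLassos ↔ NoBoxTowers :=
  ⟨noBoxTowers_of_noFinLassos, noFinLassos_of_noBoxTowers⟩

/-- **THE FINITE-FIELD CUT (EXACT)**: `FinWalksTerminate ⟺ NoFinLassos ∧ NoEscapingWalks` — a divergent witness over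
a finite field is a lasso or escapes. [PROVED] [folklore] -/
theorem finWalksTerminate_iff : FinWalksTerminate ↔ NoFinLassos ∧ NoEscapingWalks := by
  refine ⟨fun h => ⟨noFinLassos_of_finWalks h, noEscaping_of_finWalks h⟩, fun h => ?_⟩
  obtain ⟨hL, hE⟩ := h
  intro p hp e he K _ _ _ _ _ s₀ hs W
  rcases aperiodic_or_repeat W with hA | ⟨t₀, t₁, hlt, heq⟩
  · exact hE p hp e he K s₀ hs W (unbounded_of_aperiodic W hA)
  · exact hL p hp e he K s₀ hs (lassoOf W hlt heq)

end FiniteFields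

end Summit.ResolutionOfSingularities.ResolutionOfSingularities.Theorems.LassoCut
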